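import Summits.CriticalPhenomena.PercolationContinuityZ3.Theorems.Transplant.SkelFrmQuasi1RootHoldsQ3VRPx
import Summits.CriticalPhenomena.PercolationContinuityZ3.Theorems.Transplant.SkelFrmQuasiBChoiceSlotsPx
import Summits.CriticalPhenomena.PercolationContinuityZ3.Theorems.Transplant.SkelFrmQuasi1ParamsLBL
import Summits.CriticalPhenomena.PercolationContinuityZ3.Theorems.Transplant.SkelFrmQuasiBChoiceAtQ
import Summits.CriticalPhenomena.PercolationContinuityZ3.Theorems.Transplant.SkelFrmQuasiBChoiceAtQ3V
import Summits.CriticalPhenomena.PercolationContinuityZ3.Theorems.Transplant.SkelFrmQuasiBChoiceDefs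
import Summits.CriticalPhenomena.PercolationContinuityZ3.Theorems.Transplant.SkelFrmQuasiBChoiceResidC
import Summits.CriticalPhenomena.PercolationContinuityZ3.Theorems.Transplant.SkelFrmQuasiBChoiceResidQV
import Summits.CriticalPhenomena.PercolationContinuityZ3.Theorems.Transplant.SkelFrmQuasiBChoiceResidR
import Summits.CriticalPhenomena.PercolationContinuityZ3.Theorems.Transplant.SkelFrmQuasiBChoiceRootReadDischarge
import Summits.CriticalPhenomena.PercolationContinuityZ3.Theorems.Transplant.SkelFrmQuasiBChoiceRootReadRows
import Summits.CriticalPhenomena.PercolationContinuityZ3.Theorems.Transplant.SkelFrmQuasiBChoiceRows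
import Summits.CriticalPhenomena.PercolationContinuityZ3.Theorems.Transplant.SkelFrmQuasiBParamsKitS
import Summits.CriticalPhenomena.PercolationContinuityZ3.Theorems.Transplant.SkelFrmQuasiBParamsLFA
import Summits.CriticalPhenomena.PercolationContinuityZ3.Theorems.Transplant.PlanarSkeletonFrmQuasiDefs
import Summits.CriticalPhenomena.PercolationContinuityZ3.Theorems.Transplant.SkelFrmQuasi1SlotTypes
import Summits.CriticalPhenomena.PercolationContinuityZ3.Theorems.Transplant.SkelPhiQStepsN
import HarnessLib

/-!
# GEN-Q PORT (WAVE-Q table v0.8 section 2, row G253, U-level L?; captain R-6/R-7 2026-08-27: carrier token swap `PlanarSkeletonFrmFrom ↦ PlanarSkeletonFrmQuasi`)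
# of the tree module «Transplant/SkelFrmFrom1RootHoldsQ3VNodePx» (sha256 ad39e89c2b7876b4…) onto the quasi-step carrier `PlanarSkeletonFrmQuasi` (p507026): «SkelFrmQuasi1RootHoldsQ3VNodePx»

ORIGINAL TITLE: 

builds on p205010 (kernel theorem, internal audit signed; external expert review pending) — nothing in this file uses p205010; NOTHING is claimed about any open node
((N3-b), the end state).  Lane `prim-bschramm`, seat `prim-hp-8` (gen 62; GEN-Q pen, family BChoiceRoot*/1Root*/BParamsKit·Bridge; tool = captain gen-1 g4's port_genq.py R-14 + p3-g30 T1/T2 + stmt-g33 --force-keep).  Helper file (`--supports stmt-CriticalPhenomena-4575 --as helper`).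
PORT RULES (U-wave r1–r4 re-used, GEN-Q hunk classes of p3-g29 #6136): declaration order, names and proof texts are those of «SkelFrmFrom1RootHoldsQ3VNodePx», byte-identical except
(i) the carrier token `PlanarSkeletonFrmFrom ↦ PlanarSkeletonFrmQuasi` in binders, `namespace`/`end` lines and qualified names (module names `SkelFrmFrom… ↦ SkelFrmQuasi…`
in imports of already-ported rows); (ii) `Φ.step ↦ Φ.qstep` with the called Steps lemma replaced by its `…Q`/`_q` twin and the cost `Φ.M` threaded (none in this file unless
listed below); (iii) `Φ.cyl_connected ↦ Φ.cyl_reach` readers (none unless listed); (iv) graph-ball radii / window floors ×`Φ.M` (none unless listed).  HAND HUNK (L-KitS-1 readers): the kit integers of record are read at the window cost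
`N := KS.NQ Φ` — KS.T₀a_lt_RA' κ Φ ↦ KS.T₀aN_lt_RAN' κ Φ (KS.one_le_NQ Φ) ×1 (stmt-g33's G017 «SkelFrmQuasiBChoiceNums», hp-8's «SkelFrmQuasiBParamsKitSN»).  Carrier-free
residents stay imported/exported from the original «SkelFrm1RootHoldsQ3VNodePx» exactly as in the FrmFrom port.  Docstrings and citations are the original's.

L-stmt34-2 (textual dedup at the tops): the head constant of the node theorem is spelled carrier-qualified (`PlanarSkeletonFrmQuasi.RootHoldsNQWFnLKPxAt`) so its
header is not byte-identical to the landed FrmFrom twin's; the elaborated statement is unchanged.  K-2 (p3-g30, R-25 2026-08-27): no K-2 hunk in this file — it forwards «SkelFrmQuasiBChoiceResidR» `exR0_floors` (×`Φ.M` landing depths and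
bridge floor, L-p3g30-1) to «…1RootHoldsQ3VRPx»; validated rc 0 kept whole over the staged closure (and the node text over it).
-/

noncomputable section

open scoped Classical

namespace Summit.CriticalPhenomena.PercolationContinuityZ3.Theorems.Transplant

open MeasureTheory Literature.Probability.Percolation Literature.Probability.LatticeModels SimpleGraph KNCells KNLevels
open SkelConc (Consts)
open Skelφ.StepI (DataN DataNS OutNS)

namespace PlanarSkeletonFrmQuasi

namespace NegB

open Neg

set_option maxHeartbeats 1600000 in
/-- **THE GEN (R) COLUMN PROP, ∀ D, AT THE TUPLE OF RECORD UNDER PROXIES** (TUPLE Px OF RECORD, «SkelFrmFromBChoiceSlotsPx»): for every proxy radius `D` and every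
`Kmin ≥ 200`, `RootHoldsNQWFnLKPxAt LfQ Kmin (frmChoiceAllQ3VPx D (gvPx D) (fvPx D) (PvPx D) (SUS (exPx D) (mxPx D)) (cvPx D) (hvPx D) BSlot.small3)` — the U (R)
top's proof at the raised kit index `KS.RK t Dr 0 + D` (see the module docstring). [cite: KozmaNitzan2024, §4 p. 28 ((32) at the root)] -/
theorem rootHoldsNQWFnLKPxAt_frmChoiceAllQ3VPx_node (D Kmin : ℕ) (hKmin : 200 ≤ Kmin) :
    PlanarSkeletonFrmQuasi.RootHoldsNQWFnLKPxAt LfQ Kmin (frmChoiceAllQ3VPx D (gvPx D) (fvPx D) (PvPx D) (SUS (exPx D) (mxPx D)) (cvPx D) (hvPx D) BSlot.small3) := by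
  refine rootHoldsNQWFnLKPxAt_frmChoiceAllQ3VPx_R D Kmin 0 hKmin (gvPx D) (fvPx D) (PvPx D) (exPx D) (mxPx D) (cvPx D) (hvPx D) BSlot.small3
    ?_ ?_ ?_ ?_ ?_ ?_ ?_ ?_ ?_
  · -- HgR at the raised index
    intro κ V _ _ G _ Φ t p Dr
    rw [gvPx_at, fvPx_at]
    obtain ⟨h1, -, h3⟩ := le_gT_gxQ (KS.RK t Dr 0 + D) (gxR0 (KS.RK t Dr 0 + D)) (fxR (KS.RK t Dr 0 + D)) κ Φ t p Dr
    obtain ⟨g1, g2, -⟩ := gxC_floors κ Φ t p Dr (KS.RK t Dr 0 + D)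
    exact ⟨g1.trans h1, g2.trans h1, h3, two_fT_le_gT (KS.RK t Dr 0 + D) (gxR0 (KS.RK t Dr 0 + D)) (fxR (KS.RK t Dr 0 + D)) κ Φ t p Dr⟩
  · -- HfR
    intro κ V _ _ G _ Φ t p Dr
    rw [fvPx_at]
    exact (le_fT_fxQ (KS.RK t Dr 0 + D) (fxR (KS.RK t Dr 0 + D)) κ Φ t p Dr).2.2
  · -- HexR: the six window floors at the raised index, the long-link and bridge windows at radius `+ D`
    intro κ V _ _ G _ Φ t p Dr g f
    rw [exPx_at]
    have hQ := (le_exQ (KS.RK t Dr 0 + D) (exRD (KS.RK t Dr 0 + D) D) κ Φ t p Dr g f).2.2.2.2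
    obtain ⟨h0, hL, hB⟩ := exRD_floors κ Φ t p Dr (KS.RK t Dr 0 + D) D g f hQ
    obtain ⟨-, -, h3, h4, h5, h6⟩ := exR0_floors κ Φ t p Dr (KS.RK t Dr 0 + D) g f h0
    exact ⟨by omega, hB, h3, h4, h5, h6⟩
  · -- HPx
    intro κ V _ _ G _ Φ t p Dr
    rw [PvPx_at]
    exact (subset_PR_PxQ (KS.RK t Dr 0 + D) κ Φ t p Dr (PxR (KS.RK t Dr 0 + D))).1
  · -- HRs
    intro κ V _ _ G _ Φ t p Dr f hN hκ i
    rw [gvPx_at] at hN hκ ⊢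
    have h1 := RA'_le_r_TA κ Φ t p Dr (KS.RK t Dr 0 + D) (gxQ (KS.RK t Dr 0 + D) (gxR0 (KS.RK t Dr 0 + D)) (fxR (KS.RK t Dr 0 + D))) f hN hκ i
    have h2 := (KS.T₀aN_lt_RAN' κ Φ (KS.one_le_NQ Φ) t p Dr (KS.RK t Dr 0 + D)).2.1
    have h3 : ((KS.Rs t Dr (KS.RK t Dr 0 + D) : ℕ) : ℤ) + 2 <
        ((fcellsA κ Φ t p Dr ((KS.gT (KS.RK t Dr 0 + D) (gxQ (KS.RK t Dr 0 + D) (gxR0 (KS.RK t Dr 0 + D)) (fxR (KS.RK t Dr 0 + D)))) κ Φ t p Dr) f).r i : ℤ) :=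
      lt_of_lt_of_le (by exact_mod_cast h2) h1
    omega
  · -- HX1
    intro κ V _ _ G _ Φ t p hC O q hK hAt
    have hN := eqNumL_of_atQ (atQ3_of_atQ3V hAt)
    obtain ⟨h1, -, -⟩ := le_gT_gxQ (KS.RK t O.merged 0 + D) (gxR0 (KS.RK t O.merged 0 + D)) (fxR (KS.RK t O.merged 0 + D)) κ Φ t p O.merged
    obtain ⟨g1, g2, -⟩ := gxC_floors κ Φ t p O.merged (KS.RK t O.merged 0 + D)
    exact rowX1_Q κ Φ t p O.merged _ _ (KS.RK t O.merged 0 + D) (PlanarSkeletonNeg.Neg.kq_ge_of_le κ (m := 4) (le_trans (by norm_num) hK)) hN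
      (g1.trans h1) (g2.trans h1)
  · -- HXA
    intro κ V _ _ G _ Φ t p hC O q hK hAt hg
    have hN := eqNumL_of_atQ (atQ3_of_atQ3V hAt)
    obtain ⟨h1, -, -⟩ := le_gT_gxQ (KS.RK t O.merged 0 + D) (gxR0 (KS.RK t O.merged 0 + D)) (fxR (KS.RK t O.merged 0 + D)) κ Φ t p O.merged
    obtain ⟨-, g2, -⟩ := gxC_floors κ Φ t p O.merged (KS.RK t O.merged 0 + D)
    have r := rowXA_Q κ Φ t p O.merged (gOf κ Φ t p O (gvPx D)) (fOf κ Φ t p O (fvPx D)) (KS.RK t O.merged 0 + D)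
      (PlanarSkeletonNeg.Neg.kq_ge_of_le κ (m := 4) (le_trans (by norm_num) hK)) hN hg (g2.trans h1)
    have e := bOf_small3_eq κ Φ t p O (gvPx D) (fvPx D)
    rw [← e] at r
    exact r
  · -- HX2
    intro κ V _ _ G _ Φ t p hC O q hK hAt
    have hN := eqNumL_of_atQ (atQ3_of_atQ3V hAt)
    obtain ⟨h1, -, -⟩ := le_gT_gxQ (KS.RK t O.merged 0 + D) (gxR0 (KS.RK t O.merged 0 + D)) (fxR (KS.RK t O.merged 0 + D)) κ Φ t p O.merged
    obtain ⟨g1, g2, -⟩ := gxC_floors κ Φ t p O.merged (KS.RK t O.merged 0 + D)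
    exact rowX2_Q κ Φ t p O.merged _ _ (KS.RK t O.merged 0 + D) hN (g1.trans h1) (g2.trans h1)
  · -- HYA
    intro κ V _ _ G _ Φ t p hC O q hK hAt hg
    have hN := eqNumL_of_atQ (atQ3_of_atQ3V hAt)
    obtain ⟨h1, -, -⟩ := le_gT_gxQ (KS.RK t O.merged 0 + D) (gxR0 (KS.RK t O.merged 0 + D)) (fxR (KS.RK t O.merged 0 + D)) κ Φ t p O.merged
    obtain ⟨-, g2, -⟩ := gxC_floors κ Φ t p O.merged (KS.RK t O.merged 0 + D)
    have r := rowYA_Q κ Φ t p O.merged (gOf κ Φ t p O (gvPx D)) (fOf κ Φ t p O (fvPx D)) (KS.RK t O.merged 0 + D)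
      (PlanarSkeletonNeg.Neg.kq_ge_of_le κ (m := 4) (le_trans (by norm_num) hK)) hN hg (g2.trans h1)
    have e := bOf_small3_eq κ Φ t p O (gvPx D) (fvPx D)
    rw [← e] at r
    exact r

end NegB

end PlanarSkeletonFrmQuasi

end Summit.CriticalPhenomena.PercolationContinuityZ3.Theorems.Transplant

end
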